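import Mathlib
import Summits.NavierStokesRegularity.FluidComputer.AbcClassIBasis
import Summits.NavierStokesRegularity.FluidComputer.AbcClassIISynthesis

/-!
# Class-I layer of the ABC certificate chains, Part I: the first-order matrix in the class-I orbit basis
(profile-cert-3 g9 — F5 implementation-3 seat, cell `ns-blowup`, 2026-08-27; the class-I twin of instab4 g6's
`AbcClassIIIndex`, same statements and proofs with the class-I basis families)

HONEST FRAMING (human rulings D-0035/D-0074): nothing here is a claim about Navier–Stokes blow-up.
WHAT THIS IS NOT: not NS evidence. MODEL lane (class I). Sequel of `AbcClassIDefs/Symmetry/Basis`: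
the INDEX-LEVEL inputs of the abstract Galerkin chain for the real matrix
`amat i j = Re Σ_{k∈O_i} ⟪bfam i k, Π_k X(bfam j)(k)⟫` of the certifiers' first-order part in the class-I
orbit-adapted basis:

* `amat_eq` — (E1) the matrix IS the complex pairing (reality by conjugate symmetry);
* `amat_eq_zero_of_not_mem` — (E2) BAND: `amat i j = 0` off `nbrIdx i` (`AbcLatticeLocality`);
* `norm_lerayCrossForm_bfam_le` / `abs_amat_le` — (E3) first-order GROWTH `|amat i j| ≤ 2592 √(1+|O_j|²)`
  (the pointwise bound `AbcClassII.norm_lerayCrossForm_le` is character-free);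
* `card_nbrIdx_le` (W = 288²), `one_add_onormSq_le_of_mem_nbrIdx` (band-comparable levels),
  `tendsto_levels` ((A1), the levels `−|O_i|²/R → −∞` cofinitely on the class-I index type).

Mathlib + the files named; no new definitions. bears_on LADDER-NS N5 / Z4-a(1) (CR rows T2/T4).
-/

noncomputable section

open scoped BigOperators ComplexConjugate InnerProductSpace
open Finset MeasureTheory UnitAddTorus

namespace Summit.NavierStokesRegularity.FluidComputer.AbcClassI

open Literature.Analysis.FunctionSpaces Literature.Analysis.FunctionSpaces.Torus
open Literature.Analysis.FunctionSpaces.EuclideanSpace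
open Literature.Analysis.FluidPDE Literature.Analysis.FluidPDE.SteadyLattice
open Literature.Analysis.FluidPDE.ScalarFourier
open Summit.NavierStokesRegularity.FluidComputer.AbcClassII (Fam crossForm secOp rotR rotS sgnAct sgnOrbit
  cube extend restrictTo extend_add extend_smul extend_zero rotR_add rotR_smul rotS_add rotS_smul
  crossForm_add crossForm_smul secOp_add secOp_smul restrictTo_add restrictTo_smul Orbit toOrbit onormSq
  osupNorm cubeOrbits nbrOrbits mem_sgnOrbit mem_sgnOrbit_self card_sgnOrbit_le sgnOrbit_eq_of_mem
  mem_sgnOrbit_comm sgnOrbit_eq_or_disjoint neg_mem_sgnOrbit neg_self_mem_sgnOrbit rotFreqR_mem_sgnOrbit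
  rotFreqS_mem_sgnOrbit freqNormSq_eq_of_mem_sgnOrbit supNorm_eq_of_mem_sgnOrbit mem_cube
  mem_cube_iff_supNorm cube_mono sgnOrbit_subset_cube zero_not_mem_sgnOrbit ne_zero_of_mem_sgnOrbit
  toOrbit_val toOrbit_eq_iff mem_cubeOrbits mem_nbrOrbits mem_nbrOrbits_comm card_nbrOrbits_le rotR_apply
  rotS_apply freqNormSq_rotFreq secOp_conj isConjSymm_secOp kdot_secOp mem_iff_of_orbitClosed
  isConjSymm_cut kdot_cut orbitClosed_cube_ne_zero orbitClosed_shell neg_mem_of_orbitClosed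
  isConjSymm_lerayCrossForm kdot_conj conj_eq_zero_of_not_mem linOp_zero_eq conj_theta_neg
  extend_apply_of_mem extend_apply_of_not_mem restrictTo_extend extend_restrictTo extend_sum
  inner_eq_sum_extend inner_conjVec_conjVec conj_sum_inner_of_isConjSymm sum_inner_eq_re_of_isConjSymm
  real_inner_eq_re real_smul_eq norm_lerayCrossForm_le sobolevWeight_one_eq)

/-! ## Part I. Index-level data of the abstract chain (class I): the real matrix `amat`, band, growth, levels -/

section Index

/-- **(E1) The real matrix IS the complex pairing**: `amat i j = Σ_{k ∈ O_i} ⟪bfam i k, Π_k X(bfam j)(k)⟫`. -/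
theorem amat_eq (i j : AbcClassI.Idx) : ((AbcClassI.amat i j : ℝ) : ℂ) =
    ∑ k ∈ i.1.1, (inner ℂ (AbcClassI.bfam i k) (Torus.lerayCoeff k (crossForm 1 1 1 (AbcClassI.bfam j) k)) : ℂ) := by
  rw [amat]
  exact (sum_inner_eq_re_of_isConjSymm (bfam_spec i).2.2 (isConjSymm_lerayCrossForm (bfam_spec j).2.2)
    (neg_mem_of_orbitClosed i.1.orbitClosed)).symm

/-- `Π_k X(bfam j)(k) = 0` unless some `k − s`, `s ∈ {±e_m}`, lies in the orbit of `j` (locality). -/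
theorem lerayCrossForm_bfam_eq_zero {j : AbcClassI.Idx} {k : Fin 3 → ℤ} (hk : ∀ s ∈ Torus.abcFreq, k - s ∉ j.1.1) :
    Torus.lerayCoeff k (crossForm 1 1 1 (AbcClassI.bfam j) k) = 0 := by
  have h : crossForm 1 1 1 (bfam j) k = 0 :=
    AbcLatticeLocality.crossForm_eq_zero_of_neighbours 1 1 1 (bfam j) k
      fun s hs => bfam_apply_of_not_mem j (hk s hs)
  rw [h, lerayCoeff_zero_vec]

/-- **(E2) The matrix is banded**: `amat i j = 0` unless `j ∈ nbrIdx i`. -/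
theorem amat_eq_zero_of_not_mem {i j : AbcClassI.Idx} (h : j ∉ AbcClassI.nbrIdx i) : AbcClassI.amat i j = 0 := by
  have h' : ∀ k ∈ i.1.1, ∀ s ∈ Torus.abcFreq, k - s ∉ j.1.1 := by
    intro k hk s hs hks
    exact h (mem_nbrIdx.mpr (mem_nbrOrbits.mpr ⟨k, hk, s, hs, hks⟩))
  rw [amat, Finset.sum_eq_zero fun k hk => by rw [lerayCrossForm_bfam_eq_zero (h' k hk), inner_zero_right]]
  simp

/-- `Σ_{k ∈ O_i} ‖bfam i k‖² = 1`. -/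
theorem sum_norm_sq_bfam (i : AbcClassI.Idx) : ∑ k ∈ i.1.1, ‖AbcClassI.bfam i k‖ ^ 2 = 1 := by
  have h := sum_inner_bfam (i := i) le_rfl i
  rw [if_pos rfl] at h
  have h' : ∑ k ∈ i.1.1, (inner ℂ (bfam i k) (bfam i k) : ℂ) = ∑ k ∈ i.1.1, (((‖bfam i k‖ ^ 2 : ℝ)) : ℂ) :=
    Finset.sum_congr rfl fun k _ => by rw [inner_self_eq_norm_sq_to_K]; push_cast; rfl
  rw [h', ← Complex.ofReal_sum] at h
  exact_mod_cast h

/-- `‖bfam i k‖ ≤ 1`. -/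
theorem norm_bfam_le_one (i : AbcClassI.Idx) (k : Fin 3 → ℤ) : ‖AbcClassI.bfam i k‖ ≤ 1 := by
  by_cases hk : k ∈ i.1.1
  · have h1 : ‖bfam i k‖ ^ 2 ≤ 1 := by
      rw [← sum_norm_sq_bfam i]
      exact Finset.single_le_sum (f := fun k => ‖bfam i k‖ ^ 2) (fun _ _ => sq_nonneg _) hk
    nlinarith [norm_nonneg (bfam i k)]
  · rw [bfam_apply_of_not_mem i hk, norm_zero]; exact zero_le_one

/-- **Growth on a basis family**: `‖Π_k X(bfam j)(k)‖ ≤ 54 √(1 + |O_j|²)`. -/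
theorem norm_lerayCrossForm_bfam_le (j : AbcClassI.Idx) (k : Fin 3 → ℤ) :
    ‖Torus.lerayCoeff k (crossForm 1 1 1 (AbcClassI.bfam j) k)‖ ≤ 54 * Real.sqrt (1 + onormSq j.1) := by
  refine (norm_lerayCrossForm_le (bfam j) k).trans ?_
  have hterm : ∀ y : Fin 3 × Bool, sobolevWeight 1 (k - Torus.abcDir y) * ‖bfam j (k - Torus.abcDir y)‖ ≤
      Real.sqrt (1 + onormSq j.1) := by
    intro y
    by_cases hm : k - Torus.abcDir y ∈ j.1.1
    · rw [sobolevWeight_one_eq, j.1.freqNormSq_eq hm]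
      calc Real.sqrt (1 + onormSq j.1) * ‖bfam j (k - Torus.abcDir y)‖
          ≤ Real.sqrt (1 + onormSq j.1) * 1 :=
            mul_le_mul_of_nonneg_left (norm_bfam_le_one j _) (Real.sqrt_nonneg _)
        _ = _ := mul_one _
    · rw [bfam_apply_of_not_mem j hm, norm_zero, mul_zero]; exact Real.sqrt_nonneg _
  have hsum : ∑ y : Fin 3 × Bool, sobolevWeight 1 (k - Torus.abcDir y) * ‖bfam j (k - Torus.abcDir y)‖ ≤
      6 * Real.sqrt (1 + onormSq j.1) := by
    calc ∑ y : Fin 3 × Bool, sobolevWeight 1 (k - Torus.abcDir y) * ‖bfam j (k - Torus.abcDir y)‖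
        ≤ ∑ _y : Fin 3 × Bool, Real.sqrt (1 + onormSq j.1) := Finset.sum_le_sum fun y _ => hterm y
      _ = 6 * Real.sqrt (1 + onormSq j.1) := by simp
  linarith

/-- **(E3) First-order growth of the matrix**: `|amat i j| ≤ 2592 √(1 + |O_j|²)`. -/
theorem abs_amat_le (i j : AbcClassI.Idx) : |AbcClassI.amat i j| ≤ 2592 * Real.sqrt (1 + onormSq j.1) := by
  rw [amat]
  refine (Complex.abs_re_le_norm _).trans ((norm_sum_le _ _).trans ?_)
  have hterm : ∀ k ∈ i.1.1, ‖(inner ℂ (bfam i k) (Torus.lerayCoeff k (crossForm 1 1 1 (bfam j) k)) : ℂ)‖ ≤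
      54 * Real.sqrt (1 + onormSq j.1) := by
    intro k _
    refine (norm_inner_le_norm _ _).trans ?_
    calc ‖bfam i k‖ * ‖Torus.lerayCoeff k (crossForm 1 1 1 (bfam j) k)‖
        ≤ 1 * (54 * Real.sqrt (1 + onormSq j.1)) :=
          mul_le_mul (norm_bfam_le_one i k) (norm_lerayCrossForm_bfam_le j k) (norm_nonneg _) zero_le_one
      _ = _ := one_mul _
  calc ∑ k ∈ i.1.1, ‖(inner ℂ (bfam i k) (Torus.lerayCoeff k (crossForm 1 1 1 (bfam j) k)) : ℂ)‖
      ≤ ∑ _k ∈ i.1.1, 54 * Real.sqrt (1 + onormSq j.1) := Finset.sum_le_sum hterm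
    _ = i.1.1.card * (54 * Real.sqrt (1 + onormSq j.1)) := by rw [Finset.sum_const, nsmul_eq_mul]
    _ ≤ 48 * (54 * Real.sqrt (1 + onormSq j.1)) := by
        have h48 : (i.1.1.card : ℝ) ≤ 48 := by exact_mod_cast i.1.card_le
        exact mul_le_mul_of_nonneg_right h48 (by positivity)
    _ = 2592 * Real.sqrt (1 + onormSq j.1) := by ring

/-- **Band width**: `card (nbrIdx i) ≤ 288 · 288`. -/
theorem card_nbrIdx_le (i : AbcClassI.Idx) : (AbcClassI.nbrIdx i).card ≤ 288 * 288 := by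
  obtain ⟨O, a⟩ := i
  show ((nbrOrbits O).sigma fun O' => (Finset.univ : Finset (Fin (odim O')))).card ≤ 288 * 288
  rw [Finset.card_sigma]
  calc ∑ O' ∈ nbrOrbits O, (Finset.univ : Finset (Fin (odim O'))).card
      ≤ ∑ _O' ∈ nbrOrbits O, 288 := Finset.sum_le_sum fun O' _ => by rw [Finset.card_fin]; exact odim_le O'
    _ = (nbrOrbits O).card * 288 := by rw [Finset.sum_const, smul_eq_mul]
    _ ≤ 288 * 288 := Nat.mul_le_mul_right _ (card_nbrOrbits_le O)

/-- **Neighbouring orbits have comparable levels**: for `j ∈ nbrIdx i`,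
`1 + |O_i|²/R ≤ 2(1 + 1/R)(1 + |O_j|²/R)` (instab3's `one_add_levels_le_of_neighbour`). -/
theorem one_add_onormSq_le_of_mem_nbrIdx {R : ℝ} (hR : 0 < R) {i j : AbcClassI.Idx} (h : j ∈ AbcClassI.nbrIdx i) :
    1 + onormSq i.1 / R ≤ 2 * (1 + R⁻¹) * (1 + onormSq j.1 / R) := by
  obtain ⟨k, hk, s, hs, hks⟩ := mem_nbrOrbits.mp (mem_nbrIdx.mp h)
  have hq : ∑ m, (((k m : ℤ) : ℝ) - (((k - s) m : ℤ) : ℝ)) ^ 2 ≤ 1 := by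
    obtain ⟨y, rfl⟩ := Torus.mem_abcFreq.mp hs
    have e : ∀ m, (((k m : ℤ) : ℝ) - (((k - Torus.abcDir y) m : ℤ) : ℝ)) = ((Torus.abcDir y m : ℤ) : ℝ) := by
      intro m; simp
    simp_rw [e]
    have := Torus.freqNormSq_abcDir y
    rw [freqNormSq] at this
    exact this.le
  have h1 := SkewCutGalerkinLattice.one_add_levels_le_of_neighbour (inv_nonneg.mpr hR.le) k (k - s) hq
  rw [← i.1.freqNormSq_eq hk, ← j.1.freqNormSq_eq hks, freqNormSq, freqNormSq, div_eq_inv_mul, div_eq_inv_mul]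
  exact h1

/-- The section index sets contain the representative fibres: `{i : ∀ m, |rep_i m| ≤ n} ⊆ cubeIdx n`;
in particular these fibres are finite. -/
theorem finite_rep_fibre (n : ℕ) : Set.Finite {i : AbcClassI.Idx | ∀ m, |i.1.rep m| ≤ (n : ℤ)} := by
  refine (cubeIdx n).finite_toSet.subset fun i hi => ?_
  simp only [Set.mem_setOf_eq] at hi
  rw [Finset.mem_coe, mem_cubeIdx, ← i.1.supNorm_eq i.1.rep_mem]
  exact mem_cube_iff_supNorm.mp (mem_cube.mpr hi)

/-- **(A1) The levels `−|O_i|²/R` tend to `−∞` cofinitely** (instab3's `tendsto_levels_atBot`). -/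
theorem tendsto_levels {R : ℝ} (hR : 0 < R) :
    Filter.Tendsto (fun i : AbcClassI.Idx => -(onormSq i.1 / R)) Filter.cofinite Filter.atBot := by
  have h := SkewCutGalerkinLattice.tendsto_levels_atBot (inv_pos.mpr hR) (fun i : Idx => i.1.rep) finite_rep_fibre
  refine (Filter.tendsto_congr fun i => ?_).mp h
  rw [onormSq, freqNormSq, div_eq_inv_mul]

end Index

end Summit.NavierStokesRegularity.FluidComputer.AbcClassI

end
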